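import Summits.QuantumFields.QCD.Theses.PauliWegnerSea
import Literature.MathematicalPhysics.QuantumFieldTheory.QCDTimeReflection

/-!
# Sketch — crux-ideate, crux stmt-QuantumFields-17512 (`PauliWegnerSea.ChiralOneScaleTrajectory`), ideator 1, round 1

Two idea cards, first lemmas and transfer targets typed over existing declarations (no `sorry`;
everything here is a `def … : Prop` or a plain definition).

* `LogConvexLift`  — card `log-convex-continuum-lift`
* `OnePointPin`    — card `one-point-pion-pin`
-/

noncomputable section

namespace Summit.QuantumFields.QCD.Cruxes.ChiralOneScaleTrajectory

open scoped BigOperators Topology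
open MeasureTheory Filter
open Literature.MathematicalPhysics.QuantumFieldTheory Literature.MathematicalPhysics.QuantumLattice
open Literature.Probability.LatticeModels Literature.MathematicalPhysics.AQFT

local notation "SU3" => Matrix.specialUnitaryGroup (Fin 3) ℂ

/-! ### Shared objects: the HONEST (signed Berezin) pion numerators and partition functions on the
odd torus `2S+1`, with time-PERIODIC quarks (the Statement's functional) and with the tree's
time-ANTIPERIODIC twin; their even/odd (baryon-parity) sector combinations. -/

variable {Nf : ℕ}

/-- bare masses of the regularisation at step `k` for the renormalised tuple `m` -/
def bare (reg : QCDRegularisation Nf) (m : Fin Nf → ℝ) (k : ℕ) : Fin Nf → ℝ :=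
  fun fl => reg.mcrit k + reg.a k * m fl / reg.Zm k

/-- honest periodic pion numerator `∫dμ_W ∫dψ̄dψ P_{gf}(0) P_{fg}(v) e^{-ψ̄Dψ}` (signed determinant inside) -/
def pionNumP (β : ℝ) (S : ℕ) (mq : Fin Nf → ℝ) (f g : Fin Nf) (v : Site 4) : ℂ :=
  ∫ U : GaugeConfig 4 (2 * S + 1) SU3,
    fermiIntegral (pseudoscalarBilinear g f (Torus.proj (2 * S + 1) 0) *
      pseudoscalarBilinear f g (Torus.proj (2 * S + 1) v) * fermiBoltzmann U mq)
    ∂(wilsonMeasure (fundamentalRep (Fin 3)) β)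

/-- honest antiperiodic pion numerator (tree `fermiBoltzmannAP`: the transfer-matrix trace) -/
def pionNumAP (β : ℝ) (S : ℕ) (mq : Fin Nf → ℝ) (f g : Fin Nf) (v : Site 4) : ℂ :=
  ∫ U : GaugeConfig 4 (2 * S + 1) SU3,
    fermiIntegral (pseudoscalarBilinear g f (Torus.proj (2 * S + 1) 0) *
      pseudoscalarBilinear f g (Torus.proj (2 * S + 1) v) * fermiBoltzmannAP U mq)
    ∂(wilsonMeasure (fundamentalRep (Fin 3)) β)

/-- periodic partition function `Z_P = STr T^{2S+1}` -/
def partFnP (β : ℝ) (S : ℕ) (mq : Fin Nf → ℝ) : ℂ :=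
  ∫ U : GaugeConfig 4 (2 * S + 1) SU3, fermiIntegral (fermiBoltzmann U mq)
    ∂(wilsonMeasure (fundamentalRep (Fin 3)) β)

/-- antiperiodic partition function `Z_AP = Tr T^{2S+1}` -/
def partFnAP (β : ℝ) (S : ℕ) (mq : Fin Nf → ℝ) : ℂ :=
  ∫ U : GaugeConfig 4 (2 * S + 1) SU3, fermiIntegral (fermiBoltzmannAP U mq)
    ∂(wilsonMeasure (fundamentalRep (Fin 3)) β)

/-- even (baryon-number-even) sector pion trace `N_even = (N_AP + N_P)/2` -/
def evenNum (β : ℝ) (S : ℕ) (mq : Fin Nf → ℝ) (f g : Fin Nf) (v : Site 4) : ℝ :=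
  ((pionNumAP β S mq f g v + pionNumP β S mq f g v) / 2).re

/-- odd sector pion trace `N_odd = (N_AP − N_P)/2` (three quark windings) -/
def oddNum (β : ℝ) (S : ℕ) (mq : Fin Nf → ℝ) (f g : Fin Nf) (v : Site 4) : ℝ :=
  ((pionNumAP β S mq f g v - pionNumP β S mq f g v) / 2).re

/-- even sector partition function `Z_even = (Z_AP + Z_P)/2` -/
def evenZ (β : ℝ) (S : ℕ) (mq : Fin Nf → ℝ) : ℝ := ((partFnAP β S mq + partFnP β S mq) / 2).re

/-- odd sector partition function `Z_odd = (Z_AP − Z_P)/2` -/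
def oddZ (β : ℝ) (S : ℕ) (mq : Fin Nf → ℝ) : ℝ := ((partFnAP β S mq - partFnP β S mq) / 2).re

/-- the time-axis site `n e₀` -/
def axis (n : ℕ) : Site 4 := Pi.single 0 (n : ℤ)

/-- the site `(n, z)` with time `n` and spatial part `z` -/
def tz (n : ℕ) (z : Fin 3 → ℤ) : Site 4 := Fin.cases (n : ℤ) z

/-! ## Card `log-convex-continuum-lift` -/
namespace LogConvexLift

/-- **First lemma (EvenSectorStructure).** For every `β ≥ 0`, every torus `2S+1` and every tuple of
bare masses on the physical branch `mq_f > −1` (Lüscher's positivity range `κ < 1/6`), and every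
flavour pair `f ≠ g`: the even-sector axial pion trace `n ↦ N_even(n e₀)` is real, non-negative and
LOG-CONVEX on `1 … 2S`, it dominates its spatial translates (axis maximality), and the odd sector
is non-negative: `N_odd ≥ 0`, `Z_odd ≥ 0`, `Z_even ≥ Z_odd`. All are consequences of the positive
transfer matrix of r = 1 Wilson lattice QCD with ANY number of flavours and ANY masses > −1 (the
sign of `det D_W` for odd `N_f` is invisible in the operator formalism). -/
def EvenSectorStructure (Nf : ℕ) : Prop :=
  ∀ (β : ℝ), 0 ≤ β → ∀ (S : ℕ), 1 ≤ S → ∀ (mq : Fin Nf → ℝ), (∀ fl, -1 < mq fl) →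
    ∀ (f g : Fin Nf), f ≠ g →
      (∀ n : ℕ, n ≤ 2 * S + 1 →
          (pionNumP β S mq f g (axis n)).im = 0 ∧ (pionNumAP β S mq f g (axis n)).im = 0 ∧
          0 ≤ evenNum β S mq f g (axis n) ∧ 0 ≤ oddNum β S mq f g (axis n)) ∧
      (∀ n : ℕ, 1 ≤ n → n + 1 ≤ 2 * S + 1 →
          evenNum β S mq f g (axis n) ^ 2 ≤
            evenNum β S mq f g (axis (n - 1)) * evenNum β S mq f g (axis (n + 1))) ∧
      (∀ (n : ℕ) (z : Fin 3 → ℤ), n ≤ 2 * S + 1 →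
          |evenNum β S mq f g (tz n z)| ≤ evenNum β S mq f g (axis n)) ∧
      0 ≤ oddZ β S mq ∧ oddZ β S mq ≤ evenZ β S mq ∧ (partFnP β S mq).im = 0 ∧ (partFnAP β S mq).im = 0

/-- **Smeared spectral positivity** (the form of E2 the lift actually uses): for every real,
finitely supported spatial profile `h`, the spatially autocorrelated even trace
`D(n) = Σ_{z,z'} h(z) h(z') N_even(n, z' − z)` is non-negative and log-convex in `n`
(`= Σ_{i,j even} λ_i^{N−n} λ_j^{n} |ĥ(p_i − p_j)|² |⟨j|P̂|i⟩|²`). -/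
def SmearedSpectralPositivity (Nf : ℕ) : Prop :=
  ∀ (β : ℝ), 0 ≤ β → ∀ (S : ℕ), 1 ≤ S → ∀ (mq : Fin Nf → ℝ), (∀ fl, -1 < mq fl) →
    ∀ (f g : Fin Nf), f ≠ g → ∀ (R : ℕ) (h : (Fin 3 → ℤ) → ℝ),
      let D : ℕ → ℝ := fun n =>
        ∑ z ∈ Fintype.piFinset (fun _ : Fin 3 => Finset.Icc (-(R : ℤ)) R),
          ∑ z' ∈ Fintype.piFinset (fun _ : Fin 3 => Finset.Icc (-(R : ℤ)) R),
            h z * h z' * evenNum β S mq f g (tz n (z' - z))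
      (∀ n, n ≤ 2 * S + 1 → 0 ≤ D n) ∧
        ∀ n, 1 ≤ n → n + 1 ≤ 2 * S + 1 → D n ^ 2 ≤ D (n - 1) * D (n + 1)

/-- **Odd-sector negligibility at log-scale separations** (soft: any k-uniform physical suppression
of three quark windings across the time extent `2L_k+1 ≫ |log a_k|/a_k` gives it). -/
def OddSectorNegligible (reg : QCDRegularisation Nf) : Prop :=
  ∀ (m : Fin Nf → ℝ), (∀ fl, 0 < m fl) → ∀ (f g : Fin Nf), f ≠ g → ∀ K : ℝ,
    ∀ᶠ k in atTop, 2 * oddZ (reg.β k) (reg.L k) (bare reg m k) ≤ evenZ (reg.β k) (reg.L k) (bare reg m k) ∧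
      ∀ n : ℕ, (n : ℝ) * reg.a k ≤ K * (1 + |Real.log (reg.a k)|) →
        2 * oddNum (reg.β k) (reg.L k) (bare reg m k) f g (axis n) ≤
          evenNum (reg.β k) (reg.L k) (bare reg m k) f g (axis n)

/-- **Polynomial floor at ONE physical distance** (what bounds the field renormalisation `z_k`;
implied by clause (iii) of the crux via Lyapunov `E‖G‖² ≥ (E X^s)^{2/s}/144`). -/
def PolyFloor (reg : QCDRegularisation Nf) : Prop :=
  ∀ (m : Fin Nf → ℝ), (∀ fl, 0 < m fl) → ∀ (f g : Fin Nf), f ≠ g → ∀ R : ℝ, 0 < R →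
    ∃ (p C : ℝ), 0 < C ∧ ∀ᶠ k in atTop,
      C * reg.a k ^ p * evenZ (reg.β k) (reg.L k) (bare reg m k) ≤
        evenNum (reg.β k) (reg.L k) (bare reg m k) f g (axis ⌊R / reg.a k⌋₊)

/-- **Volume room**: `a_k L_k / (1 + |log a_k|) → ∞` (a free choice of the witness `reg`). -/
def LogRoom (reg : QCDRegularisation Nf) : Prop :=
  Tendsto (fun k => reg.a k * reg.L k / (1 + |Real.log (reg.a k)|)) atTop atTop

/-- the unit time vector of Euclidean `ℝ⁴` -/
def e₀ : EuclideanSpace ℝ (Fin 4) := EuclideanSpace.single 0 1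

/-- **Transfer target (ContinuumLightnessAlong).** For every `ε > 0` some positive mass tuple `m`
has continuum data `T` along the regularisation's scheme (any species renormalisations) whose
flavour-changing pseudoscalar two-point function has AVERAGE LOGARITHMIC SLOPE `≤ ε/2` between
two time-separated bumps at physical distances `R₁ < R₂` (the far bump non-zero): by the
spectral representation of `T` this is `inf supp ρ_π(m) ≤ ε/2`, i.e. the continuum pion becomes
light as `m → 0⁺` — GMOR/Goldstone stated where chiral Ward identities are exact. -/
def ContinuumLightnessAlong (reg : QCDRegularisation Nf) : Prop :=
  ∀ ε > (0 : ℝ), ∃ m : Fin Nf → ℝ, (∀ fl, 0 < m fl) ∧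
    ∃ (z shift : QCDField Nf → ℕ → ℝ) (T : OSData (QCDField Nf) 4),
      IsQCDAlong (reg.scheme m z shift) T ∧
      ∃ (f g : Fin Nf), f ≠ g ∧
        ∃ (R₁ R₂ w : ℝ) (φ₁ φ₂ φ₃ : SchwartzMap (EuclideanSpace ℝ (Fin 4)) ℝ)
          (F₁₂ F₁₃ : SchwartzMap (Fin 2 → EuclideanSpace ℝ (Fin 4)) ℂ),
          0 < w ∧ 2 * w < R₁ ∧ R₁ + 4 * w < R₂ ∧
          (∀ x, 0 ≤ φ₁ x) ∧ (∀ x, 0 ≤ φ₂ x) ∧ (∀ x, φ₃ x = φ₂ (x - (R₂ - R₁) • e₀)) ∧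
          -- product form `φ(x₀)·h(x⃗)` (time profile `φt ≥ 0`, ANY real spatial profile `hs`): what makes the
          -- smeared lattice functional a positive window average of a spectrally positive sequence
          (∃ (φt : ℝ → ℝ) (hs : (Fin 3 → ℝ) → ℝ), (∀ s, 0 ≤ φt s) ∧
            (∀ x, φ₁ x = φt (x 0) * hs (fun i => x (Fin.succ i))) ∧
            (∀ x, φ₂ x = φt (x 0 - R₁) * hs (fun i => x (Fin.succ i)))) ∧
          tsupport φ₁ ⊆ Metric.closedBall 0 w ∧ tsupport φ₂ ⊆ Metric.closedBall (R₁ • e₀) w ∧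
          IsTensorOf F₁₂ ![ofRealTest φ₁, ofRealTest φ₂] ∧ IsOffDiagonal F₁₂ ∧
          IsTensorOf F₁₃ ![ofRealTest φ₁, ofRealTest φ₃] ∧ IsOffDiagonal F₁₃ ∧
          T.schwinger 2 (fun _ => QCDField.pseudoRe f g) F₁₃ ≠ 0 ∧
          Real.log (‖T.schwinger 2 (fun _ => QCDField.pseudoRe f g) F₁₂‖ /
              ‖T.schwinger 2 (fun _ => QCDField.pseudoRe f g) F₁₃‖) ≤ ε / 2 * (R₂ - R₁ - 4 * w)

/-- **The lift (statement of the line's composition target).** Even-sector structure + the two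
soft lattice side conditions + one polynomial floor turn continuum lightness into the Statement's
pin `reg.IsChiralAtZero`, for `N_f = 2` and `3` alike; no lattice lower bound at long distance, no
phase quenching, no reflection-positive RE-TYPING of the Statement's periodic functional. -/
def PinOfContinuumLightness (Nf : ℕ) : Prop :=
  EvenSectorStructure Nf → SmearedSpectralPositivity Nf →
    ∀ reg : QCDRegularisation Nf, LogRoom reg → OddSectorNegligible reg → PolyFloor reg →
      ContinuumLightnessAlong reg → reg.IsChiralAtZero

/-- The abstract real-variable heart of the lift (provable now): a positive log-convex sequence
decays, to the right of an interval, no faster than its average rate on that interval. -/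
def ChordExtrapolation : Prop :=
  ∀ (D : ℕ → ℝ) (n₁ n₂ N : ℕ), n₁ < n₂ → n₂ ≤ N → (∀ n, n ≤ N → 0 < D n) →
    (∀ n, 1 ≤ n → n + 1 ≤ N → D n ^ 2 ≤ D (n - 1) * D (n + 1)) →
      ∀ n, n₂ ≤ n → n ≤ N →
        Real.log (D n₂) - ((n - n₂ : ℕ) : ℝ) * (Real.log (D n₁ / D n₂) / (n₂ - n₁ : ℕ)) ≤ Real.log (D n)

end LogConvexLift

/-! ## Card `one-point-pion-pin` -/
namespace OnePointPin

/-- the crux's phase-quenched fractional moment (integrand byte-identical with clause (iii)),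
at volume `S`, displacement `v`, flavour `f`, exponent `s` -/
def fm (reg : QCDRegularisation Nf) (m : Fin Nf → ℝ) (k S : ℕ) (f : Fin Nf) (v : Site 4) (s : ℝ) : ℝ :=
  (∫ U : GaugeConfig 4 (2 * S + 1) SU3, ‖(diracMatrix U (bare reg m k)).det‖ *
      (∑ a : Fin 3, ∑ i : Fin 4, ∑ b : Fin 3, ∑ j : Fin 4,
        ‖(diracMatrix U (bare reg m k))⁻¹ (quarkEquiv (f, (Torus.proj (2 * S + 1) 0, a, i)))
          (quarkEquiv (f, (Torus.proj (2 * S + 1) v, b, j)))‖) ^ s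
      ∂(wilsonMeasure (fundamentalRep (Fin 3)) (reg.β k))) /
    (∫ U : GaugeConfig 4 (2 * S + 1) SU3, ‖(diracMatrix U (bare reg m k)).det‖
      ∂(wilsonMeasure (fundamentalRep (Fin 3)) (reg.β k)))

/-- the sign-defect part of the pair-tilted phase-quenched mass at `(k, S, n)`:
`∫_{det < 0} |det| X_f(n e₀) X_g(n e₀) dμ_W` against `∫ |det| X_f X_g dμ_W` -/
def tiltedDefect (reg : QCDRegularisation Nf) (m : Fin Nf → ℝ) (k S : ℕ) (f g : Fin Nf) (n : ℕ) : ℝ × ℝ :=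
  let X : GaugeConfig 4 (2 * S + 1) SU3 → Fin Nf → ℝ := fun U fl =>
    ∑ a : Fin 3, ∑ i : Fin 4, ∑ b : Fin 3, ∑ j : Fin 4,
      ‖(diracMatrix U (bare reg m k))⁻¹ (quarkEquiv (fl, (Torus.proj (2 * S + 1) 0, a, i)))
        (quarkEquiv (fl, (Torus.proj (2 * S + 1) (axis n), b, j)))‖
  (∫ U : GaugeConfig 4 (2 * S + 1) SU3,
      (if ((diracMatrix U (bare reg m k)).det).re < 0 then 1 else 0) *
        ‖(diracMatrix U (bare reg m k)).det‖ * (X U f * X U g)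
      ∂(wilsonMeasure (fundamentalRep (Fin 3)) (reg.β k)),
    ∫ U : GaugeConfig 4 (2 * S + 1) SU3, ‖(diracMatrix U (bare reg m k)).det‖ * (X U f * X U g)
      ∂(wilsonMeasure (fundamentalRep (Fin 3)) (reg.β k)))

/-- **Transfer target (PinAnchor).** ONE sub-`ε`-rate fractional-moment anchor of the crux's own
functional, on the time axis, at the crux's own volume `S = L_k`, at a far lattice distance,
frequently in `k` — for every `ε` at some positive tuple of our choosing (degenerate doublet for
`N_f = 2`; `(m, m, M)` for `N_f = 3`). Quantifier shape `∀ε ∃m ∃ᶠk ∃n`: no `∀ S`, no `∀ n`, no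
k-uniform constant, no UV end. -/
def PinAnchor (reg : QCDRegularisation Nf) : Prop :=
  ∀ ε > (0 : ℝ), ∃ m : Fin Nf → ℝ, (∀ fl, 0 < m fl) ∧ ∃ s : ℝ, 0 < s ∧ s ≤ 2 ∧
    ∀ C : ℝ, ∃ᶠ k in atTop, ∃ n : ℕ, n ≤ reg.L k ∧
      ∀ f : Fin Nf, C * Real.exp (-(s * ε / 2) * (reg.a k * n)) ≤ fm reg m k (reg.L k) f (axis n) s

/-- **Tilted sign coherence** (vacuous for an even number of degenerate flavours): under the
phase-quenched law tilted by the pion pair density at `(k, L_k, n)`, sign defects carry at most a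
quarter of the mass. A (iv)-type clause for a two-point-tilted ensemble at the SAME side `2L_k+1`
at which the crux owes (iv). -/
def TiltedSignCoherence (reg : QCDRegularisation Nf) : Prop :=
  ∀ (m : Fin Nf → ℝ), (∀ fl, 0 < m fl) → ∀ (f g : Fin Nf), ∀ᶠ k in atTop, ∀ n : ℕ, n ≤ reg.L k →
    4 * (tiltedDefect reg m k (reg.L k) f g n).1 ≤ (tiltedDefect reg m k (reg.L k) f g n).2

/-- **First lemma (pin_of_anchor).** The Lyapunov bridge `E‖G‖²_F ≥ (E X^s)^{2/s}/144` between the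
crux's fractional moment and the honest connected charged-pion correlator (Wick: `|corr| =
E_{signed}[tr G_f(0,n) G_g(0,n)†]`, equal to the phase-quenched mean for `N_f = 2` degenerate and
within the tilted defect of it in general) makes the pin a corollary of ONE anchor. -/
def PinOfAnchor (Nf : ℕ) : Prop :=
  ∀ reg : QCDRegularisation Nf, PinAnchor reg → TiltedSignCoherence reg → reg.IsChiralAtZero

/-- **Rate-honest clause (iii)** (the restatement under which the pin is free): the lower pin of
the crux with a rate that vanishes with the lightest mass, `C₁(m) ≤ c · √(max_f m_f)` (GMOR
scaling; any `C₁(m) → 0` would do). -/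
def RateHonestLowerPin (reg : QCDRegularisation Nf) : Prop :=
  ∃ c : ℝ, ∀ (m : Fin Nf → ℝ), (∀ fl, 0 < m fl) → ∃ (s c₀ p : ℝ), 0 < s ∧ s < 1 ∧ 0 < c₀ ∧
    ∀ᶠ k in atTop, ∀ S : ℕ, reg.L k ≤ S → ∀ (f : Fin Nf) (n : ℕ), n ≤ S →
      c₀ * Real.exp (-(c * Real.sqrt (⨆ fl, m fl) * (reg.a k * n) + p * Real.log (n + 1))) ≤
        fm reg m k S f (axis n) s

/-- rate-honest (iii) ⇒ the anchor (pure bookkeeping: take `n = L_k`, `a_k L_k → ∞`). -/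
def AnchorOfRateHonest (Nf : ℕ) : Prop :=
  ∀ reg : QCDRegularisation Nf, Tendsto (fun k => reg.a k * reg.L k) atTop atTop →
    RateHonestLowerPin reg → PinAnchor reg

end OnePointPin

end Summit.QuantumFields.QCD.Cruxes.ChiralOneScaleTrajectory

end
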